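import Summits.QuantumFields.YangMills.Theorems.PoincareLipschitzBlowDownL2Compactness
import HarnessLib

/-!
# K2 crux `BlockLipschitzL` (stmt-QuantumFields-23533) ∕ crux `HistoryTailL` (stmt-QuantumFields-19936) — REGISTERED STUB `stub_blowDownL2Compact` (Γ1) BY NAME
# (skeleton LINE 25 «CompactnessTransfer» v1.3 `Cruxes/HistoryTailL/Lines/compactness_transfer.lean` 260fb13c43e43c58, ideator ym-r3-idea-2 g14 11:49:07Z;
# route-QuantumFields-PoincareLipschitz; the stub text = px3 g7's SIGNATURE-0 093526177ac80f17 = the statement of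
# ✓`PoincareLipschitzBlowDownL2Compactness.blowDown_L2_compact` TOKEN FOR TOKEN — this file gives the registry its by-name inhabitant)

Cell `ym3-torus` (YM ladder rung R3 = continuum SU(2) Yang–Mills on the three-torus; NOT the Clay problem), width seat `ym3-torus-px3` gen 7 (the Γ1 seat).

WHAT THIS IS NOT.  Pure aliasing (`:= blowDown_L2_compact`); the content is in `PoincareLipschitzBlowDownL2Compactness` (Tychonoff for the gradient cell means; the
Kolmogorov–M. Riesz–Fréchet criterion through px15 g6's ✓`PoincareLipschitzTranslationModulusCompactness.exists_subseq_limit_of_translate` and lit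
✓`Literature.Analysis.FunctionSpaces.exists_finset_eLpNorm_sub_lt_of_translate`; the uniform `L²`-translation modulus ✓`PoincareLipschitzTranslationModulus` ∘
✓`PoincareLipschitzTwoGridCells` ∘ ✓`PoincareLipschitzLatticeTranslationPaths`; cells ✓`PoincareLipschitzBlowDownCells`).  The load-bearing stubs
`stub_uniformSmallScaleEnergy` (S1′, continuum) and `stub_latticeToContinuumLimit` (S2♭) stay OPEN; nothing of `BlockLipschitzL`, `HistoryTailL`, the organ
`hImproveCoreFlat` or the rung is proved.  YM₃ on T³ is rung R3, NOT the Clay problem.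

References: R. Alicandro, M. Cicalese, Arch. Ration. Mech. Anal. 192 (2009) [AlicandroCicalese2008] (Thm 4.1, compactness of bounded-energy spin fields);
R. A. Adams, *Sobolev Spaces* (1975) [Adams1975] (Thm 2.21, Kolmogorov–M. Riesz–Fréchet); M. Giaquinta (1983) [Giaquinta1984] (Ch. III §1).
-/

noncomputable section

open MeasureTheory Filter Topology
open scoped BigOperators
open Literature.MathematicalPhysics.QuantumFieldTheory.Balaban1983to89
open Literature.MathematicalPhysics.QuantumFieldTheory.Balaban1983to89.B4Eq19LatticeOperators (Zd box unitVec)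

namespace Summit.QuantumFields.YangMills.Theorems.PoincareLipschitzCompactnessTransferBlowDownL2CompactStub

/-- **REGISTERED STUB `stub_blowDownL2Compact` (LINE 25 v1.3, 260fb13c43e43c58), BY NAME**: `L²`-strong compactness of the piecewise-constant blow-downs of
bounded-energy unit lattice maps on the open unit cube, unit a.e. limit, with convergent dyadic block means of the rescaled discrete gradients along the same
subsequence — `:= PoincareLipschitzBlowDownL2Compactness.blowDown_L2_compact`.
[cite: AlicandroCicalese2008, Thm 4.1; Adams1975, Thm 2.21; Giaquinta1984, Ch. III §1 Thm 1.2] -/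
theorem stub_blowDownL2Compact : (∀ (Λ₀ : ℝ), 0 < Λ₀ → ∀ (u : ℕ → Zd 3 → EuclideanSpace ℝ (Fin 4)) (z : ℕ → Zd 3) (R : ℕ → ℤ), (∀ k : ℕ, (k : ℝ) + 1 ≤ R k) → (∀ (k : ℕ) (y : Zd 3), ‖u k y‖ = 1) → (∀ k : ℕ, ∑ y ∈ box (z k) (R k), ∑ μ : Fin 3, ‖(u k) (y + unitVec μ) - (u k) y‖ ^ 2 ≤ Λ₀ * R k) → ∃ (U : EuclideanSpace ℝ (Fin 3) → EuclideanSpace ℝ (Fin 4)) (φ : ℕ → ℕ), StrictMono φ ∧ AEStronglyMeasurable U (volume.restrict {x : EuclideanSpace ℝ (Fin 3) | ∀ i : Fin 3, |x i| < 1}) ∧ (∀ᵐ x ∂(volume.restrict {x : EuclideanSpace ℝ (Fin 3) | ∀ i : Fin 3, |x i| < 1}), ‖U x‖ = 1) ∧ Tendsto (fun k : ℕ => ∫ x in {x : EuclideanSpace ℝ (Fin 3) | ∀ i : Fin 3, |x i| < 1}, ‖u (φ k) (z (φ k) + fun i => ⌊(R (φ k) : ℝ) * x i⌋) - U x‖ ^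 2) atTop (𝓝 0) ∧ (∀ (m : ℕ) (j : Fin 3 → Fin (2 ^ m)) (μ : Fin 3), ∃ g : EuclideanSpace ℝ (Fin 4), Tendsto (fun k : ℕ => ∫ x in {x : EuclideanSpace ℝ (Fin 3) | ∀ i : Fin 3, (-1 : ℝ) + 2 * (j i : ℕ) / (2 : ℝ) ^ m ≤ x i ∧ x i < (-1 : ℝ) + 2 * ((j i : ℕ) + 1) / (2 : ℝ) ^ m}, (R (φ k) : ℝ) • (u (φ k) ((z (φ k) + fun i => ⌊(R (φ k) : ℝ) * x i⌋) + unitVec μ) - u (φ k) (z (φ k) + fun i => ⌊(R (φ k) : ℝ) * x i⌋))) atTop (𝓝 g))) :=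
  Summit.QuantumFields.YangMills.Theorems.PoincareLipschitzBlowDownL2Compactness.blowDown_L2_compact

end Summit.QuantumFields.YangMills.Theorems.PoincareLipschitzCompactnessTransferBlowDownL2CompactStub

end
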